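import Mathlib
import Summits.AtomisticToContinuum.FouriersLaw.Theorems.EmbeddedDrudeMourreAbelOfSpectralDensity
import HarnessLib

/-!
# Stub S3b `stub_abelFloorOfEinsteinHelfand` of line `SpectralTrichotomy`, crux `EmbeddedDrudeMourre.GreenKuboContinuation`
# (item stmt-AtomisticToContinuum-12597); signature verbatim = `Cruxes.PositiveDensity.Birth.stub_abelFloorOfEinsteinHelfand`
# (stmt-AtomisticToContinuum-14014 birth stub 2), so the same proof serves route LatticeLandauDamping.

Abelian step Einstein–Helfand ⇒ Green–Kubo (folklore): for `C(t) = ∫ cos(ωt) dσ(ω)` (finite `σ`; `C` continuous,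
`|C| ≤ σ(ℝ)`) and `Φ(t) = ∫₀ᵗ (t-s) C(s) ds`, `∫_{t>0} e^{-νt} C(t) dt = ν² ∫_{t>0} e^{-νt} Φ(t) dt` (Fubini on the
triangle `0<s<t`, inner integral `∫_s^∞ e^{-νt}(t-s)dt = e^{-νs}/ν²`), so `Dc t - K ≤ Φ(t)` gives
`∫_{t>0} e^{-νt} C ≥ ν² ∫_{t>0} e^{-νt}(Dc t - K) dt = Dc - K ν`.

Contents:
1. `abelFloor_integral_exp_neg_mul_Ioi`, `abelFloor_integral_mul_exp_neg_mul_Ioi` (+ integrability):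
   `∫_{t>0} e^{-νt} dt = 1/ν`, `∫_{t>0} t e^{-νt} dt = 1/ν²`.
2. `abelFloor_integral_exp_neg_mul_ramp`: `∫_{t>0} e^{-νt} (t-s)⁺ dt = e^{-νs}/ν²` for `s ≥ 0`
   (translation `t = u + s`).
3. `abelFloor_setIntegral_ramp_mul`: `∫_{s>0} (t-s)⁺ f(s) ds = ∫₀ᵗ (t-s) f(s) ds` for `t ≥ 0`.
4. `abelFloor_integrable_exp_neg_mul_ramp_mul`: `(t,s) ↦ e^{-νt}(t-s)⁺ f(s)` is integrable on
   `(0,∞)²` for `f` continuous and bounded (dominated by `M·t e^{-νt/2}·e^{-νs/2}`).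
5. `abelFloor_integral_exp_neg_mul_eq` (Fubini): `∫_{t>0} e^{-νt} f = ν² ∫_{t>0} e^{-νt} ∫₀ᵗ (t-s) f`,
   and the integrability of `t ↦ e^{-νt} ∫₀ᵗ (t-s) f(s) ds` on `(0,∞)`.
6. `abelFloor_continuous_cosTransform`, `abelFloor_abs_cosTransform_le`: `C` is continuous and
   `|C| ≤ σ(ℝ)`; then the stub.
-/

noncomputable section

namespace Summit.AtomisticToContinuum.FouriersLaw.Theorems.GreenKuboContinuation.SpectralTrichotomy

open Filter Topology MeasureTheory Set
open scoped InnerProductSpace ENNReal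
open Literature.MathematicalPhysics.KineticTheory.HeatConduction

/-! ### 1. Two Laplace integrals on `(0, ∞)` -/

/-- `∫_{t>0} e^{-νt} dt = 1/ν` for `ν > 0`. [folklore] -/
theorem abelFloor_integral_exp_neg_mul_Ioi {ν : ℝ} (hν : 0 < ν) :
    ∫ t in Ioi (0:ℝ), Real.exp (-(ν * t)) = 1 / ν := by
  have h := integral_exp_mul_Ioi (neg_lt_zero.2 hν) 0
  simp only [neg_mul, mul_zero, Real.exp_zero] at h
  rw [h, neg_div_neg_eq]

/-- `t ↦ e^{-νt}` is integrable on `(0, ∞)` for `ν > 0`. [folklore] -/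
theorem abelFloor_integrableOn_exp_neg_mul_Ioi {ν : ℝ} (hν : 0 < ν) :
    IntegrableOn (fun t : ℝ => Real.exp (-(ν * t))) (Ioi (0:ℝ)) := by
  refine (exp_neg_integrableOn_Ioi 0 hν).congr_fun (fun t _ => ?_) measurableSet_Ioi
  simp only [neg_mul]

/-- `∫_{t>0} t e^{-νt} dt = 1/ν²` for `ν > 0` (`Γ(2) = 1`). [folklore] -/
theorem abelFloor_integral_mul_exp_neg_mul_Ioi {ν : ℝ} (hν : 0 < ν) :
    ∫ t in Ioi (0:ℝ), t * Real.exp (-(ν * t)) = 1 / ν ^ 2 := by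
  have h := Real.integral_rpow_mul_exp_neg_mul_Ioi (by norm_num : (0:ℝ) < 2) hν
  have h2 : ∀ t ∈ Ioi (0:ℝ),
      t ^ ((2:ℝ) - 1) * Real.exp (-(ν * t)) = t * Real.exp (-(ν * t)) := by
    intro t _
    rw [show (2:ℝ) - 1 = 1 by norm_num, Real.rpow_one]
  rw [← setIntegral_congr_fun measurableSet_Ioi h2, h, Real.Gamma_two, mul_one, Real.rpow_two,
    one_div_pow]

/-- `t ↦ t e^{-νt}` is integrable on `(0, ∞)` for `ν > 0` (its integral is `1/ν² ≠ 0`).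
[folklore] -/
theorem abelFloor_integrableOn_mul_exp_neg_mul_Ioi {ν : ℝ} (hν : 0 < ν) :
    IntegrableOn (fun t : ℝ => t * Real.exp (-(ν * t))) (Ioi (0:ℝ)) :=
  .of_integral_ne_zero (by rw [abelFloor_integral_mul_exp_neg_mul_Ioi hν]; positivity)

/-! ### 2. The Laplace transform of the shifted ramp `(t - s)⁺` -/

/-- For `ν > 0` and `s ≥ 0`, `∫_{t>0} e^{-νt} (t-s)⁺ dt = e^{-νs}/ν²` (the integrand vanishes on
`(0, s]`; translate `t = u + s` on `(s, ∞)`). [folklore] -/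
theorem abelFloor_integral_exp_neg_mul_ramp {ν : ℝ} (hν : 0 < ν) {s : ℝ} (hs : 0 ≤ s) :
    ∫ t in Ioi (0:ℝ), Real.exp (-(ν * t)) * max (t - s) 0 = Real.exp (-(ν * s)) / ν ^ 2 := by
  have h1 : ∫ t in Ioi (0:ℝ), Real.exp (-(ν * t)) * max (t - s) 0 =
      ∫ t in Ioi s, Real.exp (-(ν * t)) * max (t - s) 0 := by
    refine setIntegral_eq_of_subset_of_forall_sdiff_eq_zero measurableSet_Ioi (Ioi_subset_Ioi hs)
      (fun t ht => ?_)
    have hts : t ≤ s := not_lt.1 (fun h => ht.2 h)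
    rw [max_eq_right (sub_nonpos.2 hts), mul_zero]
  have h2 : ∫ t in Ioi s, Real.exp (-(ν * t)) * max (t - s) 0 =
      ∫ u in Ioi (0:ℝ), Real.exp (-(ν * (u + s))) * max (u + s - s) 0 := by
    have h := (measurePreserving_add_right volume s).setIntegral_preimage_emb
      (measurableEmbedding_addRight s) (fun t => Real.exp (-(ν * t)) * max (t - s) 0) (Ioi s)
    rw [Set.preimage_add_const_Ioi, sub_self] at h
    exact h.symm
  have h3 : ∫ u in Ioi (0:ℝ), Real.exp (-(ν * (u + s))) * max (u + s - s) 0 =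
      ∫ u in Ioi (0:ℝ), Real.exp (-(ν * s)) * (u * Real.exp (-(ν * u))) := by
    refine setIntegral_congr_fun measurableSet_Ioi (fun u hu => ?_)
    rw [add_sub_cancel_right, max_eq_left (le_of_lt hu), mul_add, neg_add, Real.exp_add]
    ring
  rw [h1, h2, h3, integral_const_mul, abelFloor_integral_mul_exp_neg_mul_Ioi hν]
  ring

/-! ### 3. The ramp integral is the Einstein–Helfand functional -/

/-- For `t ≥ 0`, `∫_{s>0} (t-s)⁺ f(s) ds = ∫₀ᵗ (t-s) f(s) ds`. [folklore] -/
theorem abelFloor_setIntegral_ramp_mul (f : ℝ → ℝ) {t : ℝ} (ht : 0 ≤ t) :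
    ∫ s in Ioi (0:ℝ), max (t - s) 0 * f s = ∫ s in (0:ℝ)..t, (t - s) * f s := by
  rw [intervalIntegral.integral_of_le ht,
    setIntegral_eq_of_subset_of_forall_sdiff_eq_zero measurableSet_Ioi Ioc_subset_Ioi_self ?_]
  · refine setIntegral_congr_fun measurableSet_Ioc (fun s hs => ?_)
    rw [max_eq_left (sub_nonneg.2 hs.2)]
  · intro s hs
    have hts : t < s := by
      by_contra h
      exact hs.2 ⟨hs.1, not_lt.1 h⟩
    rw [max_eq_right (sub_nonpos.2 hts.le), zero_mul]

/-! ### 4. Integrability on the quadrant `(0,∞)²` -/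

/-- For `ν > 0` and `f` continuous with `|f| ≤ M`, the function `(t, s) ↦ e^{-νt} (t-s)⁺ f(s)` is
integrable on `(0,∞) × (0,∞)`: it is dominated by `M · t e^{-νt/2} · e^{-νs/2}` (on the support
`s ≤ t` one has `e^{-νt} ≤ e^{-νt/2} e^{-νs/2}` and `(t-s)⁺ ≤ t`). [folklore] -/
theorem abelFloor_integrable_exp_neg_mul_ramp_mul {ν M : ℝ} (hν : 0 < ν) {f : ℝ → ℝ}
    (hf : Continuous f) (hfM : ∀ s, |f s| ≤ M) :
    Integrable (Function.uncurry fun (t s : ℝ) => Real.exp (-(ν * t)) * max (t - s) 0 * f s)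
      ((volume.restrict (Ioi (0:ℝ))).prod (volume.restrict (Ioi (0:ℝ)))) := by
  have hν2 : 0 < ν / 2 := half_pos hν
  have h1 : Integrable (fun t : ℝ => M * (t * Real.exp (-(ν / 2 * t))))
      (volume.restrict (Ioi (0:ℝ))) :=
    (abelFloor_integrableOn_mul_exp_neg_mul_Ioi hν2).const_mul M
  have h2 : Integrable (fun s : ℝ => Real.exp (-(ν / 2 * s))) (volume.restrict (Ioi (0:ℝ))) :=
    abelFloor_integrableOn_exp_neg_mul_Ioi hν2
  have hae : ∀ᵐ z : ℝ × ℝ ∂((volume.restrict (Ioi (0:ℝ))).prod (volume.restrict (Ioi (0:ℝ)))),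
      z ∈ Ioi (0:ℝ) ×ˢ Ioi (0:ℝ) := by
    rw [Measure.prod_restrict]
    exact ae_restrict_mem (measurableSet_Ioi.prod measurableSet_Ioi)
  refine (h1.mul_prod h2).mono' (Continuous.aestronglyMeasurable (by fun_prop)) ?_
  filter_upwards [hae] with z hz
  obtain ⟨t, s⟩ := z
  obtain ⟨ht, hs⟩ := hz
  simp only [mem_Ioi] at ht hs
  simp only [Function.uncurry_apply_pair, norm_mul, Real.norm_eq_abs, Real.abs_exp]
  have hM : 0 ≤ M := le_trans (abs_nonneg _) (hfM s)
  rcases le_or_gt s t with hst | hts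
  · rw [abs_of_nonneg (le_max_right _ _), max_eq_left (sub_nonneg.2 hst)]
    have he : Real.exp (-(ν * t)) ≤ Real.exp (-(ν / 2 * t)) * Real.exp (-(ν / 2 * s)) := by
      rw [← Real.exp_add]
      exact Real.exp_le_exp.2 (by nlinarith)
    calc Real.exp (-(ν * t)) * (t - s) * |f s|
        ≤ (Real.exp (-(ν / 2 * t)) * Real.exp (-(ν / 2 * s))) * t * M := by
          refine mul_le_mul (mul_le_mul he (by linarith) (by linarith) (by positivity)) (hfM s)
            (abs_nonneg _) (by positivity)
      _ = M * (t * Real.exp (-(ν / 2 * t))) * Real.exp (-(ν / 2 * s)) := by ring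
  · rw [max_eq_right (sub_nonpos.2 hts.le), abs_zero, mul_zero, zero_mul]
    positivity

/-! ### 5. Fubini: the Abel mean of `f` is `ν²` times the Abel mean of `∫₀ᵗ (t-s) f(s) ds` -/

/-- For `ν > 0` and `f` continuous and bounded,
`∫_{t>0} e^{-νt} f(t) dt = ν² ∫_{t>0} e^{-νt} (∫₀ᵗ (t-s) f(s) ds) dt`
(Fubini on the triangle `0 < s < t`: `∫_{t>0} e^{-νt} (t-s)⁺ dt = e^{-νs}/ν²`). [folklore] -/
theorem abelFloor_integral_exp_neg_mul_eq {ν M : ℝ} (hν : 0 < ν) {f : ℝ → ℝ}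
    (hf : Continuous f) (hfM : ∀ s, |f s| ≤ M) :
    ∫ t in Ioi (0:ℝ), Real.exp (-(ν * t)) * f t =
      ν ^ 2 * ∫ t in Ioi (0:ℝ), Real.exp (-(ν * t)) * ∫ s in (0:ℝ)..t, (t - s) * f s := by
  have hint := abelFloor_integrable_exp_neg_mul_ramp_mul hν hf hfM
  have hinner : ∀ t ∈ Ioi (0:ℝ),
      ∫ s in Ioi (0:ℝ), Real.exp (-(ν * t)) * max (t - s) 0 * f s =
        Real.exp (-(ν * t)) * ∫ s in (0:ℝ)..t, (t - s) * f s := fun t ht => by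
    rw [← abelFloor_setIntegral_ramp_mul f (le_of_lt ht), ← integral_const_mul]
    refine integral_congr_ae (ae_of_all _ (fun s => ?_))
    ring
  calc ∫ t in Ioi (0:ℝ), Real.exp (-(ν * t)) * f t
      = ∫ s in Ioi (0:ℝ), ν ^ 2 *
          ∫ t in Ioi (0:ℝ), Real.exp (-(ν * t)) * max (t - s) 0 * f s := by
        refine setIntegral_congr_fun measurableSet_Ioi (fun s hs => ?_)
        rw [integral_mul_const, abelFloor_integral_exp_neg_mul_ramp hν (le_of_lt hs)]
        field_simp
    _ = ν ^ 2 * ∫ t in Ioi (0:ℝ), ∫ s in Ioi (0:ℝ), Real.exp (-(ν * t)) * max (t - s) 0 * f s := by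
        rw [integral_const_mul, integral_integral_swap hint]
    _ = ν ^ 2 * ∫ t in Ioi (0:ℝ), Real.exp (-(ν * t)) * ∫ s in (0:ℝ)..t, (t - s) * f s := by
        rw [setIntegral_congr_fun measurableSet_Ioi hinner]

/-- For `ν > 0` and `f` continuous and bounded, `t ↦ e^{-νt} ∫₀ᵗ (t-s) f(s) ds` is integrable on
`(0, ∞)` (it is the `s`-marginal of the integrable `e^{-νt}(t-s)⁺ f(s)`). [folklore] -/
theorem abelFloor_integrableOn_exp_neg_mul_mul_intervalIntegral {ν M : ℝ} (hν : 0 < ν)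
    {f : ℝ → ℝ} (hf : Continuous f) (hfM : ∀ s, |f s| ≤ M) :
    IntegrableOn (fun t : ℝ => Real.exp (-(ν * t)) * ∫ s in (0:ℝ)..t, (t - s) * f s)
      (Ioi (0:ℝ)) := by
  have hint := (abelFloor_integrable_exp_neg_mul_ramp_mul hν hf hfM).integral_prod_left
  refine IntegrableOn.congr_fun hint (fun t ht => ?_) measurableSet_Ioi
  simp only [Function.uncurry_apply_pair]
  rw [← abelFloor_setIntegral_ramp_mul f (le_of_lt ht), ← integral_const_mul]
  refine integral_congr_ae (ae_of_all _ (fun s => ?_))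
  ring

/-! ### 6. The cosine transform of a finite measure, and the stub -/

/-- `t ↦ ∫ cos(ωt) dσ(ω)` is continuous for a finite measure `σ` (dominated convergence, bound `1`).
[folklore] -/
theorem abelFloor_continuous_cosTransform (σ : Measure ℝ) [IsFiniteMeasure σ] :
    Continuous fun t : ℝ => ∫ ω, Real.cos (ω * t) ∂σ := by
  refine continuous_of_dominated (bound := fun _ => (1:ℝ))
    (fun t => Continuous.aestronglyMeasurable (by fun_prop))
    (fun t => ae_of_all _ (fun ω => ?_)) (integrable_const 1) (ae_of_all _ (fun ω => by fun_prop))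
  rw [Real.norm_eq_abs]
  exact Real.abs_cos_le_one _

/-- `|∫ cos(ωt) dσ(ω)| ≤ σ(ℝ)` for a finite measure `σ`. [folklore] -/
theorem abelFloor_abs_cosTransform_le (σ : Measure ℝ) [IsFiniteMeasure σ] (t : ℝ) :
    |∫ ω, Real.cos (ω * t) ∂σ| ≤ σ.real univ := by
  have h := norm_integral_le_of_norm_le_const (μ := σ) (f := fun ω : ℝ => Real.cos (ω * t))
    (C := 1) (ae_of_all _ (fun ω => by rw [Real.norm_eq_abs]; exact Real.abs_cos_le_one _))
  rw [one_mul, Real.norm_eq_abs] at h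
  exact h

/-- **S3b `stub_abelFloorOfEinsteinHelfand`** (≡ `Cruxes.PositiveDensity.Birth.stub_abelFloorOfEinsteinHelfand`,
verbatim; real analysis, provable). If `σ` is finite, `C(t) = ∫ cos(ωt) dσ(ω)` and
`Dc·t − K ≤ ∫₀ᵗ (t − s) C(s) ds` for all `t ≥ 0`, then `Dc − K·ν ≤ ∫_{t>0} e^{−νt} C(t) dt` for every
`ν > 0` (Fubini on the triangle: `∫₀^∞ e^{−νt} C = ν² ∫₀^∞ e^{−νt} Φ(t) dt`). [folklore] -/
theorem stub_abelFloorOfEinsteinHelfand :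
    ∀ (σ : MeasureTheory.Measure ℝ) (C : ℝ → ℝ) (Dc K : ℝ), MeasureTheory.IsFiniteMeasure σ →
      (∀ t : ℝ, C t = MeasureTheory.integral σ (fun ω : ℝ => Real.cos (ω * t))) →
      (∀ t : ℝ, 0 ≤ t → Dc * t - K ≤ intervalIntegral (fun s : ℝ => (t - s) * C s) 0 t MeasureTheory.volume) →
      ∀ ν : ℝ, 0 < ν →
        Dc - K * ν ≤ MeasureTheory.integral (MeasureTheory.volume.restrict (Set.Ioi (0:ℝ)))
          (fun t : ℝ => Real.exp (-(ν * t)) * C t) := by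
  intro σ C Dc K hσ hC hfloor ν hν
  -- `C` is continuous and bounded by `σ(ℝ)` (this is where the finiteness of `σ` is used)
  have hCfun : C = fun t => ∫ ω, Real.cos (ω * t) ∂σ := funext hC
  have hCcont : Continuous C := by
    rw [hCfun]
    exact abelFloor_continuous_cosTransform σ
  have hCbd : ∀ t, |C t| ≤ σ.real univ := fun t => by
    rw [hC t]
    exact abelFloor_abs_cosTransform_le σ t
  -- the comparison function `e^{-νt}(Dc t - K)` and its integral `Dc/ν² - K/ν`
  have hlow : IntegrableOn (fun t : ℝ => Real.exp (-(ν * t)) * (Dc * t - K)) (Ioi (0:ℝ)) := by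
    have h : IntegrableOn (fun t : ℝ => Dc * (t * Real.exp (-(ν * t))) - K * Real.exp (-(ν * t)))
        (Ioi (0:ℝ)) :=
      Integrable.sub' ((abelFloor_integrableOn_mul_exp_neg_mul_Ioi hν).const_mul Dc)
        ((abelFloor_integrableOn_exp_neg_mul_Ioi hν).const_mul K)
    refine h.congr_fun (fun t _ => ?_) measurableSet_Ioi
    ring
  have hval : ∫ t in Ioi (0:ℝ), Real.exp (-(ν * t)) * (Dc * t - K) = Dc / ν ^ 2 - K / ν := by
    have h1 : ∫ t in Ioi (0:ℝ), Real.exp (-(ν * t)) * (Dc * t - K) =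
        ∫ t in Ioi (0:ℝ), (Dc * (t * Real.exp (-(ν * t))) - K * Real.exp (-(ν * t))) :=
      setIntegral_congr_fun measurableSet_Ioi (fun t _ => by ring)
    rw [h1, integral_sub ((abelFloor_integrableOn_mul_exp_neg_mul_Ioi hν).const_mul Dc)
      ((abelFloor_integrableOn_exp_neg_mul_Ioi hν).const_mul K), integral_const_mul,
      integral_const_mul, abelFloor_integral_mul_exp_neg_mul_Ioi hν,
      abelFloor_integral_exp_neg_mul_Ioi hν]
    ring
  -- the identity `∫ e^{-νt} C = ν² ∫ e^{-νt} Φ` and monotonicity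
  rw [abelFloor_integral_exp_neg_mul_eq hν hCcont hCbd]
  calc Dc - K * ν = ν ^ 2 * (Dc / ν ^ 2 - K / ν) := by
        field_simp
    _ = ν ^ 2 * ∫ t in Ioi (0:ℝ), Real.exp (-(ν * t)) * (Dc * t - K) := by rw [hval]
    _ ≤ ν ^ 2 * ∫ t in Ioi (0:ℝ), Real.exp (-(ν * t)) * ∫ s in (0:ℝ)..t, (t - s) * C s := by
        refine mul_le_mul_of_nonneg_left ?_ (by positivity)
        refine setIntegral_mono_on hlow
          (abelFloor_integrableOn_exp_neg_mul_mul_intervalIntegral hν hCcont hCbd)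
          measurableSet_Ioi (fun t ht => ?_)
        exact mul_le_mul_of_nonneg_left (hfloor t (le_of_lt ht)) (Real.exp_pos _).le

end Summit.AtomisticToContinuum.FouriersLaw.Theorems.GreenKuboContinuation.SpectralTrichotomy

end
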